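import Summits.RiemannHypothesis.RiemannHypothesis.Theorems.IntegerScrewDiscreteLandau
import Literature.NumberTheory.LFunctions.ZetaScrewGrowthMomentsProofs

/-!
# Splittings — the GRADED SCREW FLOOR dictionary (cell rh-split, seat (screw, bridge), gen 9)

`Ψ = zetaScrew` (Suzuki2023 (1.1)).  For every grade `η ≥ 0` the following are EQUIVALENT
(RH-free kernel theorems, no conjectural input):

* (Z) every non-trivial zero `ρ` of `ζ` has `|Re ρ - 1/2| ≤ η` — for `η > 0` this is the printed
  QUASI-RIEMANN HYPOTHESIS `QuasiRiemannHypothesis (1/2 + η)` ("`ζ(s) ≠ 0` for `Re s > 1/2 + η`",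
  Iwaniec–Kowalski §5.7; Titchmarsh §14), for `η = 0` it is RH;
* (F) GRADED FLOOR: `∃ K, ∀ t ≥ 0, Ψ(t) ≥ -K e^{ηt}`;
* (A) GRADED TWO-SIDED BOUND: `∃ K, ∀ t, |Ψ(t)| ≤ K e^{η|t|}`;
* (N) GRADED NODE FLOOR: `∃ K, ∀ m ≥ 1, Ψ(log m) ≥ -K m^η`.

(`quasiRH_iff_exp_floor`, `quasiRH_iff_abs_le_exp`, `quasiRH_iff_node_floor`, `strip_iff_exp_floor`.)
At `η = 0` this is Suzuki2023 Thm 1.6 / Thm 1.7 (`riemannHypothesis_iff_zetaScrew_bounded`,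
`IntegerScrewDiscreteLandau.robustLandau`); at `η = 1/2` it is vacuous (Thm 1.1 (3)).  The two halves:

* `gradedLandau` (F ⇒ Z): Landau's lemma for the non-negative `g(x) = Ψ(log x) + K x^η`, whose
  transform `s^{-2}(ξ'/ξ)(1/2+s) + K/(s-η)` is holomorphic on `{Re s > 1} ∪ W₀` for a thin rectangle
  `W₀` around the real segment `(η, 2]` — the slack's only pole is `s = η` — so absolute convergence is
  pushed below every `ε > η`, and a zero `w₀` of `ξ(1/2+·)` with `Re w₀ > η` clashes orders
  (`ord ξ' + 1 = ord ξ`) exactly as in `robustLandau` (the case `η = 0`, whose text this generalises);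
* `abs_zetaScrew_le_of_strip` (Z ⇒ A): the UNCONDITIONAL zero series
  `Ψ(t) = Σ_ρ m(ρ)(cosh((ρ-1/2)t) - 1)/(ρ-1/2)²` (`Suzuki2023_thm11_series_holds`) with
  `‖cosh(w)‖ ≤ e^{|Re w|}`, `|Re(ρ - 1/2)| ≤ η`, `‖ρ - 1/2‖² ≥ γ²` and `Σ 2m(ρ)/γ² < ∞`
  (`ZetaScrewGrowth.summable_two_mul_order_div_im_sq`).

Corollaries: `rh_iff_subpower_node_slack` / `rh_iff_subexp_floor` (RH ⟺ for every `ε > 0` a floor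
`-K_ε m^ε` at the integer nodes — `DiscreteLandau` sharpened from constant slack to every sub-power slack;
this is the statement `SparseScrew.SubexpSlackDetect` of line power-sparse-detect made a theorem), and
`omegaDepth` = VERBATIM the registered stub `Sig.stub_omegaDepth` of line `power-sparse-detect` on crux
`IntegerScrew.ScrewPolyFloor` (stmt-RiemannHypothesis-15757): a zero with `Re ρ > 1/2 + η` forces
`Ψ(t) < -K e^{ηt}` beyond every `T`, for every `K`.

BRIDGE-LENS READING (card SPLIT-screw-bridge §14): the one printed, open, weaker-than-RH zero-LOCATION
family (quasi-RH(θ), θ ∈ (1/2,1)) has an EXACT screw-side image — graded floors — and is thereby booked as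
a DICTIONARY ROW (RH-free equivalence), not a splitting: it buys a floor `-K e^{ηt}`, never a pivot sign
`d_M > 0` (every fixed-cut tail is RH, `ScrewBridge.bridge_iff`) and never an index bound (`ETAIL ⟺ FOZ`,
`ScrewKreinDiscreteCore.etail_iff_foz`).  Nothing in this file is a claim about the truth of RH.

`Summit.RiemannHypothesis` is by definition Mathlib's `RiemannHypothesis` (`Summit.RiemannHypothesis_iff`).
Zero `def`s; imports only tree modules; axioms standard (propext, Classical.choice, Quot.sound).

CARVE (cell rh-split, lead RULING #89, referee rh-split-ref-2 g2 11:08:51Z): this module is §1 (graded Landau detection,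
F ⇒ Z: `integrableOn_const_mul_rpow_graded`, `integrableOn_gradedShift_iff`, `gradedLandau`) of seat (screw, bridge) g9's
`ScrewGradedFloor.lean` (sha16 4aa81474636fe141, 617 l), lines 1–315 VERBATIM; §§2–6 (zero side, quasi-RH dictionary, node
floor, RH corollaries, the registered stub `stub_omegaDepth`) are `Splittings/ScrewGradedFloorDictionary.lean`, which re-opens
this namespace so every fully-qualified name stays as checked.  HONEST LABEL: «DICTIONARY ROW (RH-free equivalence quasi-RH(½+η)
⟺ graded screw floor), not a splitting; a splitting A ∧ B ⟹ RH is CONDITIONAL bookkeeping unless A and B are both proved;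
nothing here bears on the truth of RH.»
-/

noncomputable section

set_option linter.dupNamespace false

open Complex Filter Topology Set MeasureTheory

namespace Summit.RiemannHypothesis.RiemannHypothesis.Theorems.Splittings.ScrewGradedFloor

open Literature.NumberTheory.LFunctions
open Literature.NumberTheory.LFunctions.ZetaScrewLandau
open ZetaZeros.riemannZetaNontrivialZeros

/-! ## 1. Graded Landau detection (F ⇒ Z) -/

/-- The graded slack `K x^{η-(σ+1)}` is integrable on `(1, ∞)` for `σ > η`. -/
theorem integrableOn_const_mul_rpow_graded (K η : ℝ) {σ : ℝ} (hσ : η < σ) :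
    IntegrableOn (fun x : ℝ ↦ K * x ^ (η - (σ + 1))) (Ioi 1) :=
  (integrableOn_Ioi_rpow_of_lt (by linarith) zero_lt_one).const_mul K

/-- Adding the graded slack `K x^η` to `Ψ∘log` does not change absolute convergence of the Mellin
integrand on `(1, ∞)` at any `σ > η`. -/
theorem integrableOn_gradedShift_iff (K η : ℝ) {σ : ℝ} (hσ : η < σ) :
    IntegrableOn (fun x : ℝ ↦ (zetaScrew (Real.log x) + K * x ^ η) * x ^ (-(σ + 1))) (Ioi 1) ↔
      IntegrableOn (fun x : ℝ ↦ zetaScrew (Real.log x) * x ^ (-(σ + 1))) (Ioi 1) := by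
  have hK : IntegrableOn (fun x : ℝ ↦ K * x ^ η * x ^ (-(σ + 1))) (Ioi 1) := by
    refine (integrableOn_const_mul_rpow_graded K η hσ).congr_fun (fun x hx ↦ ?_) measurableSet_Ioi
    have hx0 : (0 : ℝ) < x := zero_lt_one.trans hx
    show K * x ^ (η - (σ + 1)) = K * x ^ η * x ^ (-(σ + 1))
    rw [show η - (σ + 1) = η + (-(σ + 1)) by ring, Real.rpow_add hx0]
    ring
  constructor
  · intro h
    refine (h.sub hK).congr_fun (fun x _ ↦ ?_) measurableSet_Ioi
    simp only [Pi.sub_apply]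
    ring
  · intro h
    refine (h.add hK).congr_fun (fun x _ ↦ ?_) measurableSet_Ioi
    simp only [Pi.add_apply]
    ring

/-- **Graded Landau detection.** If `Ψ(t) ≥ -K e^{ηt}` for all `t ≥ 0` (`η ≥ 0`), then `ξ(1/2 + w₀) ≠ 0`
for every `Re w₀ > η`.  (`η = 0` is `IntegerScrewDiscreteLandau.robustLandau`; Suzuki2023 §7.2 with the
slack `K x^η`, whose transform `K/(s-η)` has its only pole at `s = η`.) -/
theorem gradedLandau {η K : ℝ} (hη : 0 ≤ η)
    (hΨ : ∀ t : ℝ, 0 ≤ t → -K * Real.exp (η * t) ≤ zetaScrew t) :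
    ∀ w₀ : ℂ, η < w₀.re → riemannXi (1 / 2 + w₀) ≠ 0 := by
  intro w₀ hw₀ hzero
  -- zeros of `ξ(1/2 + ·)` have real part `< 1/2`, so `η < 1/2`
  have hw₀' : w₀.re < 1 / 2 := by
    by_contra h
    exact riemannXi_ne_zero_of_one_le_re (by simp; linarith) hzero
  have hη2 : η < 1 / 2 := lt_trans hw₀ hw₀'
  have hg₀ : Measurable (fun x : ℝ ↦ zetaScrew (Real.log x)) :=
    continuous_zetaScrew.measurable.comp Real.measurable_log
  have hg : Measurable (fun x : ℝ ↦ zetaScrew (Real.log x) + K * x ^ η) :=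
    hg₀.add ((measurable_id.pow_const η).const_mul K)
  set R : ℂ → ℂ := fun s ↦ 1 / s ^ 2 * logDeriv riemannXi (1 / 2 + s) with hR_def
  set Φ : ℂ → ℂ := fun s ↦ R s + (K : ℂ) / (s - η) with hΦ_def
  -- the abscissa we push to, `η < ε < Re w₀`, and the left edge `η < ε' < ε` of the rectangle
  set ε : ℝ := (η + w₀.re) / 2 with hε_def
  have hηε : η < ε := by rw [hε_def]; linarith
  have hεw : ε < w₀.re := by rw [hε_def]; linarith
  have hε : 0 < ε := lt_of_le_of_lt hη hηε
  have hε1 : ε < 1 := by linarith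
  set ε' : ℝ := (η + ε) / 2 with hε'_def
  have hηε' : η < ε' := by rw [hε'_def]; linarith
  have hε'ε : ε' < ε := by rw [hε'_def]; linarith
  have hε'0 : 0 < ε' := lt_of_le_of_lt hη hηε'
  -- a zero-free thin rectangle around the real segment `[ε', 3]`
  set Kc : Set ℂ := (fun σ : ℝ ↦ (σ : ℂ)) '' Icc ε' 3 with hKc_def
  have hKcc : IsCompact Kc := (isCompact_Icc.image Complex.continuous_ofReal)
  set U : Set ℂ := {s : ℂ | riemannXi (1 / 2 + s) ≠ 0} with hU_def
  have hUo : IsOpen U := by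
    have : U = (fun s : ℂ ↦ riemannXi (1 / 2 + s)) ⁻¹' {0}ᶜ := rfl
    rw [this]
    exact isOpen_compl_singleton.preimage (differentiable_riemannXi.continuous.comp (by fun_prop))
  have hKU : Kc ⊆ U := by
    rintro _ ⟨σ, _, rfl⟩
    exact riemannXi_half_add_ofReal_ne_zero σ
  obtain ⟨d₀, hd₀, hthick⟩ := hKcc.exists_thickening_subset_open hUo hKU
  set W₀ : Set ℂ := {s : ℂ | ε' < s.re ∧ s.re < 3 ∧ -d₀ < s.im ∧ s.im < d₀} with hW₀_def
  have hW₀eq : W₀ = {s : ℂ | ε' < s.re} ∩ ({s : ℂ | s.re < 3} ∩ ({s : ℂ | -d₀ < s.im} ∩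
      {s : ℂ | s.im < d₀})) := by
    ext s; simp [hW₀_def]
  have hW₀o : IsOpen W₀ := by
    rw [hW₀eq]
    exact (isOpen_lt continuous_const Complex.continuous_re).inter
      ((isOpen_lt Complex.continuous_re continuous_const).inter
        ((isOpen_lt continuous_const Complex.continuous_im).inter
          (isOpen_lt Complex.continuous_im continuous_const)))
  have hW₀c : Convex ℝ W₀ := by
    rw [hW₀eq]
    exact (convex_halfSpace_re_gt _).inter ((convex_halfSpace_re_lt _).inter
      ((convex_halfSpace_im_gt _).inter (convex_halfSpace_im_lt _)))
  have hW₀U : W₀ ⊆ U := by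
    intro s hs
    refine hthick (Metric.mem_thickening_iff.2 ⟨(s.re : ℂ), ⟨s.re, ⟨hs.1.le, hs.2.1.le⟩, rfl⟩, ?_⟩)
    rw [dist_eq_norm]
    have : s - (s.re : ℂ) = (s.im : ℂ) * I := by
      apply Complex.ext <;> simp
    rw [this, norm_mul, Complex.norm_I, mul_one, Complex.norm_real, Real.norm_eq_abs, abs_lt]
    exact ⟨hs.2.2.1, hs.2.2.2⟩
  have hW₀r : ∀ σ : ℝ, ε < σ → σ ≤ 1 + 1 → (σ : ℂ) ∈ W₀ := by
    intro σ h1 h2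
    simp only [hW₀_def, Set.mem_setOf_eq, ofReal_re, ofReal_im, neg_lt_zero]
    exact ⟨by linarith, by linarith, hd₀, hd₀⟩
  -- `Φ = R + K/(s-η)` is holomorphic on `{Re s > 1} ∪ W₀` (the slack's pole `η` and `0` are outside)
  have hΦd : DifferentiableOn ℂ Φ ({s : ℂ | 1 < s.re} ∪ W₀) := by
    intro s hs
    have hsre : ε' < s.re := by
      rcases hs with hs | hs
      · simp only [Set.mem_setOf_eq] at hs; linarith
      · exact hs.1
    have hs0 : s ≠ 0 := by
      intro h0
      rw [h0, zero_re] at hsre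
      linarith
    have hsη : s - (η : ℂ) ≠ 0 := by
      intro h0
      have := congrArg Complex.re h0
      simp at this
      linarith
    have hξ : riemannXi (1 / 2 + s) ≠ 0 := by
      rcases hs with hs | hs
      · exact riemannXi_ne_zero_of_one_le_re (by simp only [Set.mem_setOf_eq] at hs; simp; linarith)
      · exact hW₀U hs
    have h1 : DifferentiableAt ℂ R s := differentiableAt_R hs0 hξ
    have h2 : DifferentiableAt ℂ (fun s : ℂ ↦ (K : ℂ) / (s - η)) s :=
      (differentiableAt_const _).div (differentiableAt_id.sub (differentiableAt_const _)) hsη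
    exact (h1.add h2).differentiableWithinAt
  -- and agrees with the transform of `g = Ψ∘log + K x^η` on `Re s > 1`
  have hagree : EqOn Φ (Landau.mellinIoi (fun x : ℝ ↦ zetaScrew (Real.log x) + K * x ^ η))
      {s : ℂ | 1 < s.re} := by
    intro s hs
    simp only [Set.mem_setOf_eq] at hs
    have hc : ((η : ℂ) - (s + 1)).re < -1 := by simp; linarith
    have hΨint : Integrable (fun x : ℝ ↦ ((zetaScrew (Real.log x) : ℝ) : ℂ) * (x : ℂ) ^ (-(s + 1)))
        (volume.restrict (Ioi 1)) := by
      have h := Landau.integrable_mellinIntegrand hg₀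
        (integrableOn_zetaScrew_log_rpow (σ := 1) (by norm_num)) 0 (s := s) hs
      refine h.congr (Eventually.of_forall fun x ↦ ?_)
      simp [Landau.mellinIntegrand]
    have hKint : Integrable (fun x : ℝ ↦ (K : ℂ) * (x : ℂ) ^ ((η : ℂ) - (s + 1)))
        (volume.restrict (Ioi 1)) :=
      (integrableOn_Ioi_cpow_of_lt hc zero_lt_one).const_mul _
    have hsη : s - (η : ℂ) ≠ 0 := by
      intro h0
      have := congrArg Complex.re h0
      simp at this
      linarith
    have hcpow : ∫ x in Ioi (1 : ℝ), (x : ℂ) ^ ((η : ℂ) - (s + 1)) = 1 / (s - η) := by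
      rw [integral_Ioi_cpow_of_lt hc zero_lt_one]
      have h : (η : ℂ) - (s + 1) + 1 = -(s - η) := by ring
      rw [h, Complex.ofReal_one, Complex.one_cpow, neg_div_neg_eq]
    have hR : R s = Landau.mellinIoi (fun x : ℝ ↦ zetaScrew (Real.log x)) s :=
      (mellinIoi_eq_of_re_gt (by linarith)).symm
    symm
    calc Landau.mellinIoi (fun x : ℝ ↦ zetaScrew (Real.log x) + K * x ^ η) s
        = ∫ x in Ioi (1 : ℝ), (((zetaScrew (Real.log x) : ℝ) : ℂ) * (x : ℂ) ^ (-(s + 1))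
            + (K : ℂ) * (x : ℂ) ^ ((η : ℂ) - (s + 1))) := by
          unfold Landau.mellinIoi
          refine setIntegral_congr_fun measurableSet_Ioi fun x hx ↦ ?_
          have hx0 : (0 : ℝ) < x := zero_lt_one.trans hx
          have hx0' : (x : ℂ) ≠ 0 := by exact_mod_cast hx0.ne'
          dsimp only
          push_cast
          rw [Complex.ofReal_cpow hx0.le η, sub_eq_add_neg (η : ℂ) (s + 1), Complex.cpow_add _ _ hx0']
          ring
      _ = Landau.mellinIoi (fun x : ℝ ↦ zetaScrew (Real.log x)) s
            + (K : ℂ) * ∫ x in Ioi (1 : ℝ), (x : ℂ) ^ ((η : ℂ) - (s + 1)) := by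
          rw [integral_add hΨint hKint, integral_const_mul]
          rfl
      _ = Φ s := by
          rw [hcpow]
          simp only [hΦ_def, hR]
          ring
  -- Landau for the non-negative `g`: absolute convergence for every `σ > ε`
  have hint : IntegrableOn (fun x : ℝ ↦ (zetaScrew (Real.log x) + K * x ^ η) * x ^ (-((1 : ℝ) + 1)))
      (Ioi 1) :=
    (integrableOn_gradedShift_iff K η (by linarith : η < 1)).2
      (integrableOn_zetaScrew_log_rpow (by norm_num))
  have hpos : ∀ x : ℝ, 1 < x → 0 ≤ zetaScrew (Real.log x) + K * x ^ η := by
    intro x hx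
    have hx0 : (0 : ℝ) < x := zero_lt_one.trans hx
    have h := hΨ (Real.log x) (Real.log_pos hx).le
    have hexp : Real.exp (η * Real.log x) = x ^ η := by
      rw [Real.rpow_def_of_pos hx0, mul_comm]
    rw [hexp] at h
    linarith
  have hS' : ∀ σ' : ℝ, ε < σ' →
      IntegrableOn (fun x : ℝ ↦ (zetaScrew (Real.log x) + K * x ^ η) * x ^ (-(σ' + 1))) (Ioi 1) :=
    fun σ' hσ' ↦ Landau.integrableOn_of_differentiableOn_union_convex hg hint le_rfl hpos
      hε1 hW₀o hW₀c hW₀r hΦd hagree hσ'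
  -- hence for `Ψ∘log` itself (the slack term is integrable for `σ' > η`)
  have hS : ∀ σ' : ℝ, ε < σ' →
      IntegrableOn (fun x : ℝ ↦ zetaScrew (Real.log x) * x ^ (-(σ' + 1))) (Ioi 1) :=
    fun σ' hσ' ↦ (integrableOn_gradedShift_iff K η (hηε.trans hσ')).1 (hS' σ' hσ')
  -- from here on verbatim `robustLandau`: holomorphy of `F` on `Re s > ε`, identity theorem, orders
  set F : ℂ → ℂ := Landau.mellinIoi (fun x : ℝ ↦ zetaScrew (Real.log x)) with hF_def
  have hFdiff : DifferentiableOn ℂ F {s : ℂ | ε < s.re} :=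
    Landau.differentiableOn_mellinIoi_of_forall hg₀ hS
  have hFR : EqOn F R {s : ℂ | 1 < s.re} := by
    intro s hs
    simp only [Set.mem_setOf_eq] at hs
    exact mellinIoi_eq_of_re_gt (by linarith)
  set H : Set ℂ := {s : ℂ | ε < s.re} with hH_def
  have hHo : IsOpen H := isOpen_lt continuous_const Complex.continuous_re
  have hHpre : IsPreconnected H := (convex_halfSpace_re_gt ε).isPreconnected
  set Z : ℂ → ℂ := fun s ↦ riemannXi (1 / 2 + s) with hZ_def
  have hZd : Differentiable ℂ Z := differentiable_riemannXi.comp (by fun_prop)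
  have hZa : ∀ s, AnalyticAt ℂ Z s := fun s ↦ hZd.analyticAt s
  have hderivZ : ∀ s, deriv Z s = deriv riemannXi (1 / 2 + s) := fun s ↦ by
    simp only [hZ_def]
    exact deriv_comp_const_add riemannXi (1 / 2) s
  set G : ℂ → ℂ := fun s ↦ F s * s ^ 2 with hG_def
  have hGa : ∀ s ∈ H, AnalyticAt ℂ G s := fun s hs ↦
    ((hFdiff.analyticOnNhd hHo) s hs).mul ((analyticAt_id.pow 2))
  have hf₁ : AnalyticOnNhd ℂ (G * Z) H := fun s hs ↦ (hGa s hs).mul (hZa s)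
  have hf₂ : AnalyticOnNhd ℂ (deriv Z) H := fun s _ ↦ (hZa s).deriv
  have h2H : (2 : ℂ) ∈ H := by simp [hH_def]; linarith
  have hev2 : (G * Z) =ᶠ[𝓝 (2 : ℂ)] deriv Z := by
    have hopen : IsOpen {s : ℂ | 1 < s.re} := isOpen_lt continuous_const Complex.continuous_re
    filter_upwards [hopen.mem_nhds (show (2 : ℂ) ∈ {s : ℂ | 1 < s.re} by simp)] with s hs
    have hs' : 1 < s.re := hs
    have hξ : riemannXi (1 / 2 + s) ≠ 0 := riemannXi_ne_zero_of_one_le_re (by simp; linarith)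
    have hs0 : s ≠ 0 := fun h ↦ by rw [h, zero_re] at hs'; linarith
    rw [Pi.mul_apply, hderivZ s]
    simp only [hG_def, hZ_def]
    rw [hFR hs]
    simp only [hR_def]
    rw [logDeriv_apply]
    set A : ℂ := deriv riemannXi (1 / 2 + s)
    set B : ℂ := riemannXi (1 / 2 + s)
    field_simp
  have hEqOn : EqOn (G * Z) (deriv Z) H := hf₁.eqOn_of_preconnected_of_eventuallyEq hf₂ hHpre h2H hev2
  -- orders at `w₀`
  have hw₀H : w₀ ∈ H := by
    simp only [hH_def, Set.mem_setOf_eq]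
    exact hεw
  have hev : deriv Z =ᶠ[𝓝 w₀] G * Z := by
    filter_upwards [hHo.mem_nhds hw₀H] with s hs
    exact (hEqOn hs).symm
  have hZ0 : Z w₀ = 0 := hzero
  have h1 : analyticOrderAt (deriv Z) w₀ + 1 = analyticOrderAt Z w₀ := by
    have := (hZa w₀).analyticOrderAt_deriv_add_one
    simpa [hZ0] using this
  have h2 : analyticOrderAt (deriv Z) w₀ = analyticOrderAt G w₀ + analyticOrderAt Z w₀ := by
    rw [analyticOrderAt_congr hev, analyticOrderAt_mul (hGa w₀ hw₀H) (hZa w₀)]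
  rw [h2] at h1
  -- `Z` is not locally zero (else `ξ ≡ 0`), so its order is finite, contradiction
  generalize hoZ : analyticOrderAt Z w₀ = oZ at h1
  generalize hoG : analyticOrderAt G w₀ = oG at h1
  cases oZ with
  | top =>
    have hloc : ∀ᶠ s in 𝓝 w₀, Z s = 0 := analyticOrderAt_eq_top.1 hoZ
    have hall : EqOn Z 0 univ :=
      (hZd.differentiableOn.analyticOnNhd isOpen_univ).eqOn_zero_of_preconnected_of_eventuallyEq_zero
        isPreconnected_univ (Set.mem_univ w₀) hloc
    have h1' : Z 1 = 0 := hall (Set.mem_univ 1)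
    simp only [hZ_def] at h1'
    exact riemannXi_ne_zero_of_one_le_re (s := 1 / 2 + 1) (by norm_num) h1'
  | coe n =>
    cases oG with
    | top => simp at h1
    | coe m =>
      have h' : (m + n + 1 : ℕ) = n := by exact_mod_cast h1
      omega

end Summit.RiemannHypothesis.RiemannHypothesis.Theorems.Splittings.ScrewGradedFloor

end
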